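import Summits.Ventures.PercRepro.MSTwinProduct

/-!
# Lemma A of Theorem S: a twin-free element of a tight family has a nonempty partner family

Fix a tight family `F` and an element `r` lying in some member and missing some other. Write
`P = proj r F` for the projection, `F₀ = part0 r F` (members avoiding `r`), `F₁ = partr r F`
(members containing `r`, with `r` removed) and `K = partner r F = F₀ ∩ F₁`. If `K = ∅`, then
`X ∩ Y = K \\ K = ∅` (`tight_proj_and_partner`), which is a **collision principle**
(`collision_principle`): for `t, s, t', s' ∈ P` with `t \ s = t' \ s'`, the pair `(t, s)` is of
type `(F₁, F₀)` iff `(t', s')` is — otherwise the common difference `E` would have both `E` and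
`insert r E` among the differences of `F`, so `E ∈ K \\ K` (`mem_diffs_partner_of_both`).

Given the class dichotomy of `P` (the induction hypothesis of Theorem S), the collision principle
forces, for every twin class `q` of `P`: if `q` is removable then either `F₁` is closed under
removing `q` or `q ⊆ t ⟺ t ∈ F₁` for all `t ∈ P`, i.e. the elements of `q` are twins of `r`
in `F` (`closedRem_partr_of_closedRem`); dually for addable classes and `F₀`
(`closedAdd_part0_of_closedAdd`). So if `r` has no twin, every member of `F₁` keeps its
`Rstar P`-part inside `F₁` and every member of `F₀` absorbs `Rstar P` inside `F₀` — a member of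
`F₁` contained in a member of `F₀`, which the collision principle at the difference `∅` forbids.
Hence **`K ≠ ∅` for every twin-free `r`** (`partner_nonempty_of_twinFree`): Lemma A of
proofs/MINE1-theoremS.md, proved here without minimal elements or complement symmetry.
-/

namespace PercRepro.MSTight

open Finset
open scoped FinsetFamily

variable {α : Type*} [DecidableEq α]

/-- Members of the projection along `r` avoid `r`. -/
theorem notMem_of_mem_proj {F : Finset (Finset α)} {r : α} {t : Finset α} (ht : t ∈ proj r F) :
    r ∉ t := by
  obtain ⟨B, _, rfl⟩ := mem_proj.1 ht
  exact Finset.notMem_erase r B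

/-- A member of the projection avoids `r` or, with `r` restored, is a member. -/
theorem mem_part0_or_mem_partr {F : Finset (Finset α)} {r : α} {t : Finset α}
    (ht : t ∈ proj r F) : t ∈ part0 r F ∨ t ∈ partr r F := by
  rw [proj_eq_union] at ht
  exact mem_union.1 ht

/-- `part0 r F ⊆ proj r F`. -/
theorem mem_proj_of_mem_part0 {F : Finset (Finset α)} {r : α} {t : Finset α}
    (ht : t ∈ part0 r F) : t ∈ proj r F := by
  rw [proj_eq_union]; exact mem_union.2 (Or.inl ht)

/-- `partr r F ⊆ proj r F`. -/
theorem mem_proj_of_mem_partr {F : Finset (Finset α)} {r : α} {t : Finset α}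
    (ht : t ∈ partr r F) : t ∈ proj r F := by
  rw [proj_eq_union]; exact mem_union.2 (Or.inr ht)

/-- With an empty partner family, no set lies in both halves. -/
theorem notMem_part0_of_mem_partr {F : Finset (Finset α)} {r : α} (hK : partner r F = ∅)
    {t : Finset α} (ht : t ∈ partr r F) : t ∉ part0 r F := by
  intro h0
  have : t ∈ partner r F := mem_inter.2 ⟨h0, ht⟩
  rw [hK] at this
  exact notMem_empty _ this

/-- **The collision principle.** With an empty partner family, pairs of projected members with
the same difference have the same type. -/
theorem collision_principle {F : Finset (Finset α)} (hF : Tight F) {r : α}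
    (hK : partner r F = ∅) {t s t' s' : Finset α} (ht : t ∈ proj r F) (hs : s ∈ proj r F)
    (ht' : t' ∈ proj r F) (hs' : s' ∈ proj r F) (heq : t \ s = t' \ s')
    (h : t ∈ partr r F ∧ s ∈ part0 r F) : t' ∈ partr r F ∧ s' ∈ part0 r F := by
  by_contra hneg
  have hrt : r ∉ t := notMem_of_mem_proj ht
  have hrt' : r ∉ t' := notMem_of_mem_proj ht'
  have hrs : r ∉ s := notMem_of_mem_proj hs
  have hrE : r ∉ t \ s := fun h' => hrt (mem_sdiff.1 h').1
  have h1 : insert r (t \ s) ∈ F \\ F := by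
    refine mem_diffs.2 ⟨insert r t, (mem_partr.1 h.1).2, s, (mem_part0.1 h.2).1, ?_⟩
    ext x
    simp only [mem_insert, mem_sdiff]
    constructor
    · rintro ⟨rfl | hx, hxs⟩
      · exact Or.inl rfl
      · exact Or.inr ⟨hx, hxs⟩
    · rintro (rfl | ⟨hx, hxs⟩)
      · exact ⟨Or.inl rfl, hrs⟩
      · exact ⟨Or.inr hx, hxs⟩
  have h2 : t \ s ∈ F \\ F := by
    rw [heq]
    rcases mem_part0_or_mem_partr ht' with ht'0 | ht'1
    · rcases mem_part0_or_mem_partr hs' with hs'0 | hs'1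
      · exact mem_diffs.2 ⟨t', (mem_part0.1 ht'0).1, s', (mem_part0.1 hs'0).1, rfl⟩
      · refine mem_diffs.2 ⟨t', (mem_part0.1 ht'0).1, insert r s', (mem_partr.1 hs'1).2, ?_⟩
        ext x
        simp only [mem_sdiff, mem_insert, not_or]
        constructor
        · rintro ⟨hx, _, hxs⟩
          exact ⟨hx, hxs⟩
        · rintro ⟨hx, hxs⟩
          exact ⟨hx, fun h => hrt' (h ▸ hx), hxs⟩
    · have hs'1 : s' ∈ partr r F := by
        rcases mem_part0_or_mem_partr hs' with hs'0 | hs'1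
        · exact absurd ⟨ht'1, hs'0⟩ hneg
        · exact hs'1
      refine mem_diffs.2 ⟨insert r t', (mem_partr.1 ht'1).2, insert r s', (mem_partr.1 hs'1).2, ?_⟩
      ext x
      simp only [mem_sdiff, mem_insert, not_or]
      constructor
      · rintro ⟨rfl | hx, hxr, hxs⟩
        · exact absurd rfl hxr
        · exact ⟨hx, hxs⟩
      · rintro ⟨hx, hxs⟩
        exact ⟨Or.inr hx, fun h => hrt' (h ▸ hx), hxs⟩
  have := mem_diffs_partner_of_both hF hrE h2 h1
  rw [hK] at this
  simp at this

variable [Fintype α]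

/-- If membership in `partr r F` is «contains the class of `a`» on the projection, then `a` is a
twin of `r` in `F`. -/
theorem twin_of_forall_mem_partr_iff {F : Finset (Finset α)} {r a : α} (hK : partner r F = ∅)
    (har : a ≠ r)
    (key : ∀ t' ∈ proj r F, t' ∈ partr r F ↔ cls (proj r F) a ⊆ t') : Twin F r a := by
  intro A hA
  have hAP : A.erase r ∈ proj r F := mem_proj.2 ⟨A, hA, rfl⟩
  have h1 : r ∈ A ↔ A.erase r ∈ partr r F := by
    constructor
    · intro hrA
      exact mem_partr.2 ⟨notMem_erase r A, by rw [insert_erase hrA]; exact hA⟩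
    · intro h
      by_contra hrA
      have hA0 : A.erase r ∈ part0 r F := by
        rw [erase_eq_of_notMem hrA]
        exact mem_part0.2 ⟨hA, hrA⟩
      exact notMem_part0_of_mem_partr hK h hA0
  have h2 : a ∈ A ↔ a ∈ A.erase r := by
    rw [mem_erase]
    exact ⟨fun h => ⟨har, h⟩, fun h => h.2⟩
  rw [h1, key _ hAP, h2]
  exact ⟨fun h => h (self_mem_cls _ a), fun h => cls_subset_of_mem hAP h⟩

/-- A removable class of the projection is a twin class of `r` or leaves `partr r F` closed under
its removal. -/
theorem closedRem_partr_of_closedRem {F : Finset (Finset α)} (hF : Tight F) {r : α}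
    (hK : partner r F = ∅) (htf : ∀ x, Twin F r x → x = r) {a : α}
    (hrem : ClosedRem (proj r F) (cls (proj r F) a)) :
    ∀ t ∈ partr r F, t \ cls (proj r F) a ∈ partr r F := by
  set P := proj r F with hP
  intro t ht
  by_contra hnot
  have htP : t ∈ P := mem_proj_of_mem_partr ht
  have htq : t \ cls P a ∈ P := hrem t htP
  have ht0 : t \ cls P a ∈ part0 r F := (mem_part0_or_mem_partr htq).resolve_right hnot
  have hqt : cls P a ⊆ t := by
    by_contra hq
    obtain ⟨y, hy, hyt⟩ := not_subset.1 hq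
    have hdisj : Disjoint (cls P a) t := by
      rw [cls_eq_of_twin (mem_cls.1 hy)]
      exact disjoint_cls_of_notMem htP hyt
    rw [sdiff_eq_self_of_disjoint hdisj.symm] at hnot
    exact hnot ht
  have hat : a ∈ t := hqt (self_mem_cls P a)
  have har : a ≠ r := fun h => notMem_of_mem_proj htP (h ▸ hat)
  have key : ∀ t' ∈ P, t' ∈ partr r F ↔ cls P a ⊆ t' := by
    intro t' ht'
    constructor
    · intro ht'1
      by_contra hq'
      obtain ⟨y, hy, hyt'⟩ := not_subset.1 hq'
      have hdisj : Disjoint (cls P a) t' := by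
        rw [cls_eq_of_twin (mem_cls.1 hy)]
        exact disjoint_cls_of_notMem ht' hyt'
      have heq : t' \ (t \ cls P a) = t' \ t := by
        ext x
        simp only [mem_sdiff, not_and, not_not]
        constructor
        · rintro ⟨hx, h'⟩
          exact ⟨hx, fun hxt => disjoint_right.1 hdisj hx (h' hxt)⟩
        · rintro ⟨hx, hxt⟩
          exact ⟨hx, fun h => absurd h hxt⟩
      have := collision_principle hF hK ht' htq ht' htP heq ⟨ht'1, ht0⟩
      exact notMem_part0_of_mem_partr hK ht this.2
    · intro hq'
      have ht'q : t' \ cls P a ∈ P := hrem t' ht'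
      have heq : t \ (t \ cls P a) = t' \ (t' \ cls P a) := by
        rw [Finset.sdiff_sdiff_eq_self hqt, Finset.sdiff_sdiff_eq_self hq']
      exact (collision_principle hF hK htP htq ht' ht'q heq ⟨ht, ht0⟩).1
  exact har (htf a (twin_of_forall_mem_partr_iff hK har key))

/-- An addable class of the projection is a twin class of `r` or leaves `part0 r F` closed under
its addition. -/
theorem closedAdd_part0_of_closedAdd {F : Finset (Finset α)} (hF : Tight F) {r : α}
    (hK : partner r F = ∅) (htf : ∀ x, Twin F r x → x = r) {a : α}
    (hadd : ClosedAdd (proj r F) (cls (proj r F) a)) :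
    ∀ t ∈ part0 r F, t ∪ cls (proj r F) a ∈ part0 r F := by
  set P := proj r F with hP
  intro t ht
  by_contra hnot
  have htP : t ∈ P := mem_proj_of_mem_part0 ht
  have htq : t ∪ cls P a ∈ P := hadd t htP
  have ht1 : t ∪ cls P a ∈ partr r F := (mem_part0_or_mem_partr htq).resolve_left hnot
  have hdisj : Disjoint (cls P a) t := by
    by_contra hd
    obtain ⟨y, hy, hyt⟩ := not_disjoint_iff.1 hd
    have hq : cls P a ⊆ t := cls_subset_of_twinClosed_of_mem (twinClosed_of_mem htP) hy hyt
    rw [union_eq_left.2 hq] at hnot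
    exact hnot ht
  have hat : a ∈ t ∪ cls P a := mem_union.2 (Or.inr (self_mem_cls P a))
  have har : a ≠ r := fun h => notMem_of_mem_proj htq (h ▸ hat)
  have key : ∀ t' ∈ P, t' ∈ partr r F ↔ cls P a ⊆ t' := by
    intro t' ht'
    constructor
    · intro ht'1
      by_contra hq'
      obtain ⟨y, hy, hyt'⟩ := not_subset.1 hq'
      have hdisj' : Disjoint (cls P a) t' := by
        rw [cls_eq_of_twin (mem_cls.1 hy)]
        exact disjoint_cls_of_notMem ht' hyt'
      have ht'q : t' ∪ cls P a ∈ P := hadd t' ht'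
      have heq : (t ∪ cls P a) \ t = (t' ∪ cls P a) \ t' := by
        rw [union_sdiff_cancel_left hdisj.symm, union_sdiff_cancel_left hdisj'.symm]
      have := collision_principle hF hK htq htP ht'q ht' heq ⟨ht1, ht⟩
      exact notMem_part0_of_mem_partr hK ht'1 this.2
    · intro hq'
      by_contra ht'1
      have ht'0 : t' ∈ part0 r F := (mem_part0_or_mem_partr ht').resolve_right ht'1
      have heq : (t ∪ cls P a) \ t' = t \ t' := by
        ext x
        simp only [mem_sdiff, mem_union]
        constructor
        · rintro ⟨hx | hx, hxt'⟩
          · exact ⟨hx, hxt'⟩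
          · exact absurd (hq' hx) hxt'
        · rintro ⟨hx, hxt'⟩
          exact ⟨Or.inl hx, hxt'⟩
      have := collision_principle hF hK htq ht' htP ht' heq ⟨ht1, ht'0⟩
      exact notMem_part0_of_mem_partr hK this.1 ht
  exact har (htf a (twin_of_forall_mem_partr_iff hK har key))

/-- **Lemma A.** In a tight family, an element `r` without twins that lies in some member and
misses some other has a nonempty partner family, provided the projection along `r` satisfies
the class dichotomy. -/
theorem partner_nonempty_of_twinFree {F : Finset (Finset α)} (hF : Tight F) {r : α}
    {t₁ : Finset α} (ht₁ : t₁ ∈ F) (hrt₁ : r ∈ t₁) {t₀ : Finset α} (ht₀ : t₀ ∈ F) (hrt₀ : r ∉ t₀)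
    (htf : ∀ x, Twin F r x → x = r) (hP : Dichotomy (proj r F)) : (partner r F).Nonempty := by
  by_contra hKne
  have hK : partner r F = ∅ := not_nonempty_iff_eq_empty.1 hKne
  set P := proj r F with hPdef
  set R := Rstar P with hR
  have hs1 : t₁.erase r ∈ partr r F :=
    mem_partr.2 ⟨notMem_erase r t₁, by rw [insert_erase hrt₁]; exact ht₁⟩
  have hs0 : t₀ ∈ part0 r F := mem_part0.2 ⟨ht₀, hrt₀⟩
  have hP1 : t₁.erase r ∈ P := mem_proj_of_mem_partr hs1
  have hP0 : t₀ ∈ P := mem_proj_of_mem_part0 hs0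
  have hA : t₁.erase r \ (t₁.erase r \ R) ∈ partr r F :=
    sdiff_mem_of_forall_sdiff_cls_mem (P := P) (G := partr r F) (t₁.erase r \ R)
      ((twinClosed_of_mem hP1).sdiff (twinClosed_Rstar P))
      (fun a ha => closedRem_partr_of_closedRem hF hK htf
        (closedRem_of_notMem_Rstar hP (mem_sdiff.1 ha).2)) _ hs1
  have hB : t₀ ∪ (R \ t₀) ∈ part0 r F :=
    union_mem_of_forall_union_cls_mem (P := P) (G := part0 r F) (R \ t₀)
      ((twinClosed_Rstar P).sdiff (twinClosed_of_mem hP0))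
      (fun a ha => closedAdd_part0_of_closedAdd hF hK htf (mem_Rstar.1 (mem_sdiff.1 ha).1)) _ hs0
  have hAB : (t₁.erase r \ (t₁.erase r \ R)) \ (t₀ ∪ (R \ t₀)) =
      (t₁.erase r \ (t₁.erase r \ R)) \ (t₁.erase r \ (t₁.erase r \ R)) := by
    rw [sdiff_self]
    apply sdiff_eq_empty_iff_subset.2
    intro x hx
    simp only [mem_sdiff, not_and, not_not] at hx
    by_cases hxt : x ∈ t₀
    · exact mem_union.2 (Or.inl hxt)
    · exact mem_union.2 (Or.inr (mem_sdiff.2 ⟨hx.2 hx.1, hxt⟩))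
  have hAP : t₁.erase r \ (t₁.erase r \ R) ∈ P := mem_proj_of_mem_partr hA
  have hBP : t₀ ∪ (R \ t₀) ∈ P := mem_proj_of_mem_part0 hB
  have := collision_principle hF hK hAP hBP hAP hAP hAB ⟨hA, hB⟩
  exact notMem_part0_of_mem_partr hK hA this.2

end PercRepro.MSTight
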